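import Literature.NumberTheory.Automorphic.Liu2021.AppendixC.TowerMorphism
import HarnessLib

/-!
# COMPOSITION of morphisms of towers and of their étale pull-backs: the receptacles `Sec42Data.TowerHom` /
# `Sec42Data.EtaleTowerHom` are FUNCTORIAL (typer row T2-R2′ of the cell's LIU415-SPEC §7)

Topic `NumberTheory/Automorphic/Liu2021/AppendixC`; namespace `Literature.NumberTheory.Automorphic.Liu2021.AppendixC`.
REAL DEFINITIONS + THEOREMS only; NO named fact, NO instance, NO notation, NO `sorry`; net Literature debt 0; nothing of
[Liu2021] is asserted.

`AppendixC/TowerMorphism.lean` (★) types a morphism of towers `{X⋆_{φ⁻¹K ∩ K₀⋆}}_K → {X_K}_K` over `E` along a continuous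
group map `φ` ([Milne2005ShimuraVarieties] Thm. 13.6), compatible with every admissible pair of Hecke translates from every
admissible source level (`Sec42Data.TowerHom`), and the same with its pull-back on `H¹_ét(A_∞)` pinned by ONE defining square
(`Sec42Data.EtaleTowerHom`).  This file composes them — [Milne2005ShimuraVarieties] §5 p. 58 L6–11 (composition of the maps
`T(g)` / of morphisms of inverse systems) and Rem. 13.8 p. 119 (morphisms of Shimura data compose):

* §1 (group-generic) `C5.levelInf K K'` — the intersection of two sufficiently small levels (open ∩ open, compact ∩ closed),
  the refined source level the composite's Hecke law is routed through; `C5.pullbackLevel_comp_le` /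
  `C5.pullbackLevel_pullbackLevel_le` / `C5.pullbackLevel_comp_eq` — `(ψφ)⁻¹K ∩ K₀¹ = φ⁻¹(ψ⁻¹K ∩ K₀²) ∩ K₀¹` granted the
  threshold compatibility `φ(K₀¹) ⊆ K₀²`; `C5.le_pullbackLevel_levelInf_heckeLevel` — the level bookkeeping of the Hecke law.
* §2 **`Sec42Data.TowerHom.comp hK₀ M₂₃ M₁₂ : TowerHom C₁ C₃ T₁ T₃ (ψ.comp φ) (hψ.comp hφ)`** —
  `map K := T₁_1 ≫ M₁₂.map (ψ⁻¹K ∩ K₀²) ≫ M₂₃.map K` (the translate by `1` from `(ψφ)⁻¹K ∩ K₀¹` to `φ⁻¹(ψ⁻¹K ∩ K₀²) ∩ K₀¹`,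
  a genuine morphism between equal-but-not-syntactically-equal level objects; NO `eqToHom`/`cast`); the Hecke law `map_tr`
  from the two `map_tr`s, routed through the refined intermediate level `(φg)(ψ⁻¹K ∩ K₀²)(φg)⁻¹ ∩ K₀² ∩ (ψ⁻¹L ∩ K₀²)`;
  unfoldings `comp_map`, **`comp_albMap`** (`Alb` is functorial: `Alb_u ≫ Alb(M₁₂.map) ≫ Alb(M₂₃.map)`), `comp_etPullLevel`.
* §3 **`Sec42Data.EtaleTowerHom.comp hK₀ M₂₃ M₁₂`** — `etPull ℓ := M₁₂.etPull ℓ ∘ₗ M₂₃.etPull ℓ`; the defining square from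
  the two squares, `comp_albMap`, contravariant functoriality of `ᵗV_ℓ` (★ `dualMap_rationalTateModuleMap_comp_apply`) and
  ★ `Sec42Data.toTower_pull`; `comp_etPull` (rfl); **`etPull_eq_comp_of_map_eq`** — by ★ `etPull_unique`, ANY étale receptacle
  over the composite geometric datum pulls back by the composite of the pull-backs (so the K-b lift
  `TowerHom.toEtaleTowerHom` of `AppendixC/TowerMorphismLift.lean` satisfies
  `(M₂₃.comp M₁₂).toEtaleTowerHom.etPull = M₁₂….etPull ∘ₗ M₂₃….etPull` as a one-line corollary where both are imported).
* NOT here: the identity (`AppendixC/TowerMorphismRefl.lean`, K-a) and the lift from the geometric datum (K-b).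

## References
* [Milne2005ShimuraVarieties] J. S. Milne, *Introduction to Shimura varieties* (2005), §5 p. 57–58 (Def. 5.14; composition
  p. 58 L6–11), §13 p. 118 L21–28, Thm. 13.6 p. 118, Rem. 13.8 p. 119.
* [Liu2021] Y. Liu, *Fourier–Jacobi cycles and arithmetic relative trace formula*, §4.2 l. 2060–2074, §4.3 l. 2152–2160,
  Thm. 4.18 proof l. 2258–2290.
* Tree: `AppendixC.TowerMorphism` (★ p640334), `AppendixC.HeckeTranslates` (`tr_one`, `tr_mul`, `tr_congr`, `map_comp_tr`,
  `albTr_one`, `heckeLevel`), `AppendixC.AlbaneseFunctorial` (`Albanese.map_comp`), `AppendixC.EtaleH1Tower` (`toTower_pull`),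
  `AppendixC.EtaleHeckeDatumOfTranslates` (`dualMap_rationalTateModuleMap_comp_apply`).
-/

set_option autoImplicit false

noncomputable section

open CategoryTheory NumberField
open scoped TensorProduct

namespace Literature.NumberTheory.Automorphic.Liu2021.AppendixC

open Literature.AlgebraicGeometry.Motives (AbelianVariety)
open Literature.AlgebraicGeometry.Motives.AbelianVariety (rationalTateModuleMap)

/-! ## §1 Intersections of levels; the pull-back level along a composite (group-generic) -/

namespace C5

section Inf

variable {H : Type} [Group H] [TopologicalSpace H] [IsTopologicalGroup H] {K₀ : OpenCompactSubgroup H}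

/-- **The intersection `K ∩ K'` of two sufficiently small levels** (open: both open; compact: a closed subset of the compact
`K`) — a sufficiently small level below both; the refined source levels of [Milne2005ShimuraVarieties] §13 p. 118 L21–26 live in
such intersections. [cite: Milne2005ShimuraVarieties, §13 p. 118 L21–26 and §5 p. 57–58] -/
def levelInf (K K' : SmallLevel K₀) : SmallLevel K₀ :=
  ⟨⟨K.1.1 ⊓ K'.1.1, by
      refine ⟨?_, ?_⟩
      · rw [Subgroup.coe_inf]
        exact K.1.2.1.inter K'.1.2.1
      · rw [Subgroup.coe_inf]
        exact K.1.2.2.inter_right (Subgroup.isClosed_of_isOpen _ K'.1.2.1)⟩,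
    (inf_le_left.trans K.2 : K.1.1 ⊓ K'.1.1 ≤ K₀.1)⟩

/-- The underlying subgroup of `levelInf K K'` is `K ⊓ K'` (by `rfl`). [cite: Milne2005ShimuraVarieties, §13 p. 118 L21–26] -/
theorem levelInf_val (K K' : SmallLevel K₀) : ((levelInf K K').1.1 : Subgroup H) = K.1.1 ⊓ K'.1.1 := rfl

/-- Membership: `k ∈ K ∩ K' ↔ k ∈ K ∧ k ∈ K'`. [cite: Milne2005ShimuraVarieties, §13 p. 118 L21–26] -/
theorem mem_levelInf_iff (K K' : SmallLevel K₀) (k : H) : k ∈ (levelInf K K').1.1 ↔ k ∈ K.1.1 ∧ k ∈ K'.1.1 := by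
  rw [levelInf_val, Subgroup.mem_inf]

/-- `K ∩ K' ⊆ K`. [cite: Milne2005ShimuraVarieties, §13 p. 118 L21–26] -/
theorem levelInf_le_left (K K' : SmallLevel K₀) : levelInf K K' ≤ K :=
  show (levelInf K K').1.1 ≤ K.1.1 from inf_le_left

/-- `K ∩ K' ⊆ K'`. [cite: Milne2005ShimuraVarieties, §13 p. 118 L21–26] -/
theorem levelInf_le_right (K K' : SmallLevel K₀) : levelInf K K' ≤ K' :=
  show (levelInf K K').1.1 ≤ K'.1.1 from inf_le_right

/-- `L ⊆ K → L ⊆ K' → L ⊆ K ∩ K'`. [cite: Milne2005ShimuraVarieties, §13 p. 118 L21–26] -/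
theorem le_levelInf {L K K' : SmallLevel K₀} (h : L ≤ K) (h' : L ≤ K') : L ≤ levelInf K K' :=
  show L.1.1 ≤ (levelInf K K').1.1 from le_inf h h'

end Inf

section Comp

variable {H₁ H₂ H₃ : Type} [Group H₁] [TopologicalSpace H₁] [Group H₂] [TopologicalSpace H₂] [IsTopologicalGroup H₂]
  [Group H₃] [TopologicalSpace H₃] [IsTopologicalGroup H₃]
variable {K₁ : OpenCompactSubgroup H₁} {K₂ : OpenCompactSubgroup H₂} {K₃ : OpenCompactSubgroup H₃}
variable (φ : H₁ →* H₂) (hφ : Continuous φ) (ψ : H₂ →* H₃) (hψ : Continuous ψ)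

/-- `φ⁻¹(ψ⁻¹K ∩ K₀²) ∩ K₀¹ ⊆ (ψφ)⁻¹K ∩ K₀¹` (no threshold hypothesis). [cite: Milne2005ShimuraVarieties, Rem. 13.8 p. 119 and §5 p. 58 L6–11] -/
theorem pullbackLevel_pullbackLevel_le (K : SmallLevel K₃) :
    pullbackLevel φ hφ K₁ (pullbackLevel ψ hψ K₂ K) ≤ pullbackLevel (ψ.comp φ) (hψ.comp hφ) K₁ K := by
  show (pullbackLevel φ hφ K₁ (pullbackLevel ψ hψ K₂ K)).1.1 ≤ (pullbackLevel (ψ.comp φ) (hψ.comp hφ) K₁ K).1.1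
  intro k hk
  rw [mem_pullbackLevel_iff] at hk ⊢
  rw [mem_pullbackLevel_iff] at hk
  exact ⟨hk.1.1, hk.2⟩

/-- **`(ψφ)⁻¹K ∩ K₀¹ ⊆ φ⁻¹(ψ⁻¹K ∩ K₀²) ∩ K₀¹` granted the threshold compatibility `φ(K₀¹) ⊆ K₀²`** — the level inequality behind
the composite morphism of towers (its `map K` starts with the translate by `1` across it).
[cite: Milne2005ShimuraVarieties, Rem. 13.8 p. 119 and §5 p. 58 L6–11] -/
theorem pullbackLevel_comp_le (hK₀ : K₁.1.map φ ≤ K₂.1) (K : SmallLevel K₃) :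
    pullbackLevel (ψ.comp φ) (hψ.comp hφ) K₁ K ≤ pullbackLevel φ hφ K₁ (pullbackLevel ψ hψ K₂ K) := by
  show (pullbackLevel (ψ.comp φ) (hψ.comp hφ) K₁ K).1.1 ≤ (pullbackLevel φ hφ K₁ (pullbackLevel ψ hψ K₂ K)).1.1
  intro k hk
  rw [mem_pullbackLevel_iff] at hk ⊢
  rw [mem_pullbackLevel_iff]
  exact ⟨⟨hk.1, hK₀ (Subgroup.mem_map_of_mem φ hk.2)⟩, hk.2⟩

/-- `(ψφ)⁻¹K ∩ K₀¹ = φ⁻¹(ψ⁻¹K ∩ K₀²) ∩ K₀¹` when `φ(K₀¹) ⊆ K₀²`. [cite: Milne2005ShimuraVarieties, Rem. 13.8 p. 119 and §5 p. 58 L6–11] -/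
theorem pullbackLevel_comp_eq (hK₀ : K₁.1.map φ ≤ K₂.1) (K : SmallLevel K₃) :
    pullbackLevel (ψ.comp φ) (hψ.comp hφ) K₁ K = pullbackLevel φ hφ K₁ (pullbackLevel ψ hψ K₂ K) :=
  le_antisymm (pullbackLevel_comp_le φ hφ ψ hψ hK₀ K) (pullbackLevel_pullbackLevel_le φ hφ ψ hψ K)

/-- **The level bookkeeping of the composite's Hecke law.**  For a source level `Lₛ ⊆ (ψφ)⁻¹L ∩ K₀¹` admissible for `T¹_g`
into `(ψφ)⁻¹K ∩ K₀¹` and `φ(K₀¹) ⊆ K₀²`, the image `φ(Lₛ)` lies in the refined intermediate level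
`L₂ = ((φg)(ψ⁻¹K ∩ K₀²)(φg)⁻¹ ∩ K₀²) ∩ (ψ⁻¹L ∩ K₀²)` — i.e. `Lₛ ⊆ φ⁻¹L₂ ∩ K₀¹` — so that `T²_{φg}` is admissible from `L₂`
into `ψ⁻¹K ∩ K₀²` (★ `heckeLE_heckeLevel`) and `L₂ ⊆ ψ⁻¹L ∩ K₀²`. [cite: Milne2005ShimuraVarieties, §13 p. 118 L21–26 and Rem. 13.8 p. 119] -/
theorem le_pullbackLevel_levelInf_heckeLevel (hK₀ : K₁.1.map φ ≤ K₂.1) (g : H₁) {L K : SmallLevel K₃}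
    {Lₛ : SmallLevel K₁} (hₛ : HeckeLE g Lₛ (pullbackLevel (ψ.comp φ) (hψ.comp hφ) K₁ K))
    (hL : Lₛ ≤ pullbackLevel (ψ.comp φ) (hψ.comp hφ) K₁ L) :
    Lₛ ≤ pullbackLevel φ hφ K₁
      (levelInf (heckeLevel (φ g) (pullbackLevel ψ hψ K₂ K)) (pullbackLevel ψ hψ K₂ L)) := by
  show Lₛ.1.1 ≤ (pullbackLevel φ hφ K₁ _).1.1
  intro k hk
  have hk₀ : k ∈ K₁.1 := Lₛ.2 hk
  have hφk : φ k ∈ K₂.1 := hK₀ (Subgroup.mem_map_of_mem φ hk₀)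
  rw [mem_pullbackLevel_iff, mem_levelInf_iff]
  refine ⟨⟨?_, ?_⟩, hk₀⟩
  · -- `φ k ∈ (φg)(ψ⁻¹K ∩ K₀²)(φg)⁻¹ ∩ K₀²`: `g⁻¹ k g ∈ (ψφ)⁻¹K ∩ K₀¹` by `hₛ`
    have hc := (mem_pullbackLevel_iff (ψ.comp φ) (hψ.comp hφ) K (g⁻¹ * k * g)).1 (hₛ k hk)
    rw [heckeLevel_val, Subgroup.mem_inf, Subgroup.mem_map]
    refine ⟨⟨φ (g⁻¹ * k * g), ?_, ?_⟩, hφk⟩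
    · rw [mem_pullbackLevel_iff]
      exact ⟨hc.1, hK₀ (Subgroup.mem_map_of_mem φ hc.2)⟩
    · simp only [MulEquiv.coe_toMonoidHom, MulAut.conj_apply, map_mul, map_inv]
      group
  · -- `φ k ∈ ψ⁻¹L ∩ K₀²` by `hL`
    have hl := (mem_pullbackLevel_iff (ψ.comp φ) (hψ.comp hφ) L k).1 ((show Lₛ.1.1 ≤ _ from hL) hk)
    rw [mem_pullbackLevel_iff]
    exact ⟨hl.1, hφk⟩

end Comp

end C5

/-! ## §2 Composition of morphisms of towers -/

section Sec42

variable {F E : Type} [Field F] [NumberField F] [IsTotallyReal F] [Field E] [NumberField E] [Algebra F E]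
  [IsTotallyComplex E] [Algebra.IsQuadraticExtension F E]
variable {P5₁ P5₂ P5₃ : PropC5Data F E} {iso₁ iso₂ iso₃ : ℕ → Prop}
variable {C₁ : Sec42Data P5₁ iso₁} {C₂ : Sec42Data P5₂ iso₂} {C₃ : Sec42Data P5₃ iso₃}
variable {T₁ : C₁.HeckeTranslates} {T₂ : C₂.HeckeTranslates} {T₃ : C₃.HeckeTranslates}
variable {φ : C₁.G →* C₂.G} {hφ : Continuous φ} {ψ : C₂.G →* C₃.G} {hψ : Continuous ψ}

/-- **Composition of morphisms of towers** along `φ : G₁ → G₂`, `ψ : G₂ → G₃` (granted the threshold compatibility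
`φ(K₀¹) ⊆ K₀²`, so that `(ψφ)⁻¹K ∩ K₀¹ ⊆ φ⁻¹(ψ⁻¹K ∩ K₀²) ∩ K₀¹`): `map K := T¹_1 ≫ M₁₂.map (ψ⁻¹K ∩ K₀²) ≫ M₂₃.map K`
(`T¹_1` the translate by `1` across the level inequality — a genuine morphism, no `eqToHom`); the Hecke law `map_tr` is the two
Hecke laws composed, `M₂₃`'s taken from the refined intermediate source level of `C5.le_pullbackLevel_levelInf_heckeLevel`
and `M₁₂`'s from the given `Lₛ`, glued by `M₁₂.map_comm` and the two laws of the translates (`T_1 = u`, `T_g T_{g'} = T_{gg'}`).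
[cite: Milne2005ShimuraVarieties, §5 p. 58 L6–11, Thm. 13.6 p. 118 and Rem. 13.8 p. 119]
[cite: Liu2021, §4.2 l. 2062–2074 and Thm. 4.18 proof l. 2258–2290] -/
def Sec42Data.TowerHom.comp (hK₀ : (C₁.S.K₀.1 : Subgroup C₁.G).map φ ≤ C₂.S.K₀.1)
    (M₂₃ : Sec42Data.TowerHom C₂ C₃ T₂ T₃ ψ hψ) (M₁₂ : Sec42Data.TowerHom C₁ C₂ T₁ T₂ φ hφ) :
    Sec42Data.TowerHom C₁ C₃ T₁ T₃ (ψ.comp φ) (hψ.comp hφ) where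
  map K :=
    T₁.tr 1 (C5.pullbackLevel (ψ.comp φ) (hψ.comp hφ) C₁.S.K₀ K)
        (C5.pullbackLevel φ hφ C₁.S.K₀ (C5.pullbackLevel ψ hψ C₂.S.K₀ K))
        (C5.HeckeLE.one_of_le (C5.pullbackLevel_comp_le φ hφ ψ hψ hK₀ K)) ≫
      M₁₂.map (C5.pullbackLevel ψ hψ C₂.S.K₀ K) ≫ M₂₃.map K
  map_tr g L K h Lₛ hₛ hL := by
    -- the refined intermediate source level for `M₂₃`'s Hecke law
    let L₂ : C5.SmallLevel C₂.S.K₀ :=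
      C5.levelInf (C5.heckeLevel (φ g) (C5.pullbackLevel ψ hψ C₂.S.K₀ K)) (C5.pullbackLevel ψ hψ C₂.S.K₀ L)
    have hₛ₂ : C5.HeckeLE (φ g) L₂ (C5.pullbackLevel ψ hψ C₂.S.K₀ K) :=
      (C5.heckeLE_heckeLevel (φ g) _).of_le_left (C5.levelInf_le_left _ _)
    have hL₂ : L₂ ≤ C5.pullbackLevel ψ hψ C₂.S.K₀ L := C5.levelInf_le_right _ _
    have hLₛ₂ : Lₛ ≤ C5.pullbackLevel φ hφ C₁.S.K₀ L₂ :=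
      C5.le_pullbackLevel_levelInf_heckeLevel φ hφ ψ hψ hK₀ g hₛ hL
    have hₛ₁ : C5.HeckeLE g Lₛ (C5.pullbackLevel φ hφ C₁.S.K₀ (C5.pullbackLevel ψ hψ C₂.S.K₀ K)) :=
      hₛ.le_right (C5.pullbackLevel_comp_le φ hφ ψ hψ hK₀ K)
    have h₁₂ : C5.pullbackLevel φ hφ C₁.S.K₀ L₂ ≤
        C5.pullbackLevel φ hφ C₁.S.K₀ (C5.pullbackLevel ψ hψ C₂.S.K₀ L) :=
      C5.pullbackLevel_mono φ hφ hL₂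
    -- (1) `u ≫ T¹_1 = u ≫ u` (the translate by `1` is a transition morphism)
    have e1 : C₁.cpt.X.map (homOfLE hL) ≫
        T₁.tr 1 (C5.pullbackLevel (ψ.comp φ) (hψ.comp hφ) C₁.S.K₀ L)
          (C5.pullbackLevel φ hφ C₁.S.K₀ (C5.pullbackLevel ψ hψ C₂.S.K₀ L))
          (C5.HeckeLE.one_of_le (C5.pullbackLevel_comp_le φ hφ ψ hψ hK₀ L)) =
        C₁.cpt.X.map (homOfLE hLₛ₂) ≫ C₁.cpt.X.map (homOfLE h₁₂) := by
      rw [T₁.map_comp_tr, ← Functor.map_comp]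
      exact T₁.tr_one (homOfLE hLₛ₂ ≫ homOfLE h₁₂)
    -- (2) `u ≫ M₁₂.map = M₁₂.map ≫ u₂` (`M₁₂.map_comm`)
    have e2 : C₁.cpt.X.map (homOfLE h₁₂) ≫ M₁₂.map (C5.pullbackLevel ψ hψ C₂.S.K₀ L) =
        M₁₂.map L₂ ≫ C₂.cpt.X.map (homOfLE hL₂) :=
      (M₁₂.map_comm (homOfLE hL₂)).symm
    -- (3) `M₂₃`'s Hecke law from the refined source level `L₂`
    have e3 : C₂.cpt.X.map (homOfLE hL₂) ≫ M₂₃.map L ≫ T₃.tr ((ψ.comp φ) g) L K h =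
        T₂.tr (φ g) L₂ _ hₛ₂ ≫ M₂₃.map K :=
      M₂₃.map_tr (φ g) L K h L₂ hₛ₂ hL₂
    -- (4) `M₁₂`'s Hecke law from `Lₛ`
    have e4 : C₁.cpt.X.map (homOfLE hLₛ₂) ≫ M₁₂.map L₂ ≫ T₂.tr (φ g) L₂ _ hₛ₂ =
        T₁.tr g Lₛ _ hₛ₁ ≫ M₁₂.map (C5.pullbackLevel ψ hψ C₂.S.K₀ K) :=
      M₁₂.map_tr g L₂ _ hₛ₂ Lₛ hₛ₁ hLₛ₂
    -- assemble
    simp only [Category.assoc]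
    rw [reassoc_of% e1, reassoc_of% e2, e3, reassoc_of% e4, ← Category.assoc (T₁.tr g Lₛ _ hₛ), T₁.tr_mul,
      T₁.tr_congr (mul_one g) _ hₛ₁]

namespace Sec42Data.TowerHom

variable (hK₀ : (C₁.S.K₀.1 : Subgroup C₁.G).map φ ≤ C₂.S.K₀.1)
  (M₂₃ : Sec42Data.TowerHom C₂ C₃ T₂ T₃ ψ hψ) (M₁₂ : Sec42Data.TowerHom C₁ C₂ T₁ T₂ φ hφ)

/-- Unfolding: `(M₂₃.comp M₁₂).map K = T¹_1 ≫ M₁₂.map (ψ⁻¹K ∩ K₀²) ≫ M₂₃.map K`. [cite: Milne2005ShimuraVarieties, §5 p. 58 L6–11] -/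
theorem comp_map (K : C5.SmallLevel C₃.S.K₀) :
    (comp hK₀ M₂₃ M₁₂).map K =
      T₁.tr 1 (C5.pullbackLevel (ψ.comp φ) (hψ.comp hφ) C₁.S.K₀ K)
          (C5.pullbackLevel φ hφ C₁.S.K₀ (C5.pullbackLevel ψ hψ C₂.S.K₀ K))
          (C5.HeckeLE.one_of_le (C5.pullbackLevel_comp_le φ hφ ψ hψ hK₀ K)) ≫
        M₁₂.map (C5.pullbackLevel ψ hψ C₂.S.K₀ K) ≫ M₂₃.map K := rfl

/-- **`Alb` of the composite**: `Alb((M₂₃.comp M₁₂).map K) = Alb_u ≫ Alb(M₁₂.map (ψ⁻¹K ∩ K₀²)) ≫ Alb(M₂₃.map K)` (★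
`Albanese.map_comp`, `Alb(T_1) = Alb_u` ★ `albTr_one`). [cite: Liu2021, Def. 2.3 l. 1206–1208 and §4.2 l. 2070–2074] -/
theorem comp_albMap (K : C5.SmallLevel C₃.S.K₀) :
    (comp hK₀ M₂₃ M₁₂).albMap K =
      C₁.Atr (homOfLE (C5.pullbackLevel_comp_le φ hφ ψ hψ hK₀ (K₁ := C₁.S.K₀) K)) ≫
        M₁₂.albMap (C5.pullbackLevel ψ hψ C₂.S.K₀ K) ≫ M₂₃.albMap K := by
  rw [albMap, comp_map, Albanese.map_comp, Albanese.map_comp, albMap, albMap,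
    ← T₁.albTr_one (homOfLE (C5.pullbackLevel_comp_le φ hφ ψ hψ hK₀ (K₁ := C₁.S.K₀) K))]
  rfl

/-- The level pull-back of the composite on `H¹_ét`:
`ᵗV_ℓ(Alb (M₂₃.comp M₁₂).map K) ψ' = ᵗV_ℓ(Alb_u) (M₁₂.etPullLevel (M₂₃.etPullLevel ψ'))` (★ `dualMap_rationalTateModuleMap_comp_apply`).
[cite: Liu2021, §4.3 l. 2158] -/
theorem comp_etPullLevel_apply (ℓ : ℕ) [Fact ℓ.Prime] (K : C5.SmallLevel C₃.S.K₀) (ψ' : C₃.etaleH1 ℓ K) :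
    (comp hK₀ M₂₃ M₁₂).etPullLevel ℓ K ψ' =
      (rationalTateModuleMap ℓ (C₁.Atr (homOfLE (C5.pullbackLevel_comp_le φ hφ ψ hψ hK₀ (K₁ := C₁.S.K₀) K)))).dualMap
        (M₁₂.etPullLevel ℓ _ (M₂₃.etPullLevel ℓ K ψ')) := by
  rw [etPullLevel, etPullLevel, etPullLevel, comp_albMap, dualMap_rationalTateModuleMap_comp_apply,
    dualMap_rationalTateModuleMap_comp_apply, Category.assoc]

end Sec42Data.TowerHom

/-! ## §3 Composition of étale morphisms of towers: `etPull` composes (contravariantly) -/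

/-- **Composition of morphisms of towers WITH their pull-backs on `H¹_ét(A_∞)`**: geometric datum `TowerHom.comp`, pull-back
`etPull ℓ := M₁₂.etPull ℓ ∘ M₂₃.etPull ℓ`; the defining square is the two squares composed, `comp_albMap`, the contravariant
functoriality of `ᵗV_ℓ` and ★ `Sec42Data.toTower_pull`. [cite: Liu2021, §4.3 l. 2152–2160 and Thm. 4.18 proof l. 2258–2262]
[cite: Milne2005ShimuraVarieties, §5 p. 58 L6–11 and Rem. 13.8 p. 119] -/
def Sec42Data.EtaleTowerHom.comp (hK₀ : (C₁.S.K₀.1 : Subgroup C₁.G).map φ ≤ C₂.S.K₀.1)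
    (M₂₃ : Sec42Data.EtaleTowerHom C₂ C₃ T₂ T₃ ψ hψ) (M₁₂ : Sec42Data.EtaleTowerHom C₁ C₂ T₁ T₂ φ hφ) :
    Sec42Data.EtaleTowerHom C₁ C₃ T₁ T₃ (ψ.comp φ) (hψ.comp hφ) where
  toTowerHom := Sec42Data.TowerHom.comp hK₀ M₂₃.toTowerHom M₁₂.toTowerHom
  etPull ℓ _ := M₁₂.etPull ℓ ∘ₗ M₂₃.etPull ℓ
  etPull_toTower ℓ _ K ψ' := by
    have e := Sec42Data.TowerHom.comp_etPullLevel_apply hK₀ M₂₃.toTowerHom M₁₂.toTowerHom ℓ K ψ'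
    rw [Sec42Data.TowerHom.etPullLevel, Sec42Data.TowerHom.albMap] at e
    rw [LinearMap.comp_apply, M₂₃.etPull_toTower', M₁₂.etPull_toTower']
    erw [e]
    rw [C₁.toTower_pull]

namespace Sec42Data.EtaleTowerHom

variable (hK₀ : (C₁.S.K₀.1 : Subgroup C₁.G).map φ ≤ C₂.S.K₀.1)
  (M₂₃ : Sec42Data.EtaleTowerHom C₂ C₃ T₂ T₃ ψ hψ) (M₁₂ : Sec42Data.EtaleTowerHom C₁ C₂ T₁ T₂ φ hφ)

/-- Unfolding: the composite pulls back by the composite of the pull-backs (contravariant). [cite: Liu2021, §4.3 l. 2158] -/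
theorem comp_etPull (ℓ : ℕ) [Fact ℓ.Prime] : (comp hK₀ M₂₃ M₁₂).etPull ℓ = M₁₂.etPull ℓ ∘ₗ M₂₃.etPull ℓ := rfl

/-- Unfolding: the geometric datum of the composite is the composite geometric datum.
[cite: Milne2005ShimuraVarieties, §5 p. 58 L6–11] -/
theorem comp_toTowerHom : (comp hK₀ M₂₃ M₁₂).toTowerHom = Sec42Data.TowerHom.comp hK₀ M₂₃.toTowerHom M₁₂.toTowerHom :=
  rfl

/-- **Any étale receptacle over the composite geometric datum pulls back by `M₁₂.etPull ∘ M₂₃.etPull`** (★ `etPull_unique`: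
the square pins the pull-back).  In particular the lift `TowerHom.toEtaleTowerHom` (file `AppendixC/TowerMorphismLift.lean`)
of `M₂₃.toTowerHom.comp M₁₂.toTowerHom` has this pull-back. [cite: Liu2021, §4.3 l. 2158] -/
theorem etPull_eq_comp_of_map_eq (M : Sec42Data.EtaleTowerHom C₁ C₃ T₁ T₃ (ψ.comp φ) (hψ.comp hφ))
    (hmap : M.map = (Sec42Data.TowerHom.comp hK₀ M₂₃.toTowerHom M₁₂.toTowerHom).map) (ℓ : ℕ) [Fact ℓ.Prime] :
    M.etPull ℓ = M₁₂.etPull ℓ ∘ₗ M₂₃.etPull ℓ := by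
  rw [← comp_etPull hK₀ M₂₃ M₁₂ ℓ]
  exact (comp hK₀ M₂₃ M₁₂).etPull_unique ℓ M hmap

end Sec42Data.EtaleTowerHom

/-! ## §4 Elaboration check: composites instantiate for three ARBITRARY §4.2 data -/

/-- Three arbitrary data, two étale morphisms, one composite. -/
example (hK₀ : (C₁.S.K₀.1 : Subgroup C₁.G).map φ ≤ C₂.S.K₀.1)
    (M₂₃ : Sec42Data.EtaleTowerHom C₂ C₃ T₂ T₃ ψ hψ) (M₁₂ : Sec42Data.EtaleTowerHom C₁ C₂ T₁ T₂ φ hφ) :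
    Sec42Data.EtaleTowerHom C₁ C₃ T₁ T₃ (ψ.comp φ) (hψ.comp hφ) :=
  Sec42Data.EtaleTowerHom.comp hK₀ M₂₃ M₁₂

end Sec42

end Literature.NumberTheory.Automorphic.Liu2021.AppendixC

end
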